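import Literature.NumberTheory.EllipticCurves.HeegnerPointsKolyvaginVisibleDescentPairExactProofs
import HarnessLib

/-!
# McCallum's Prop. 5.2 in the case `r = 1`, VISIBLE pair form, any prime `p`: a SHALLOW depth-one
# certificate yields a DEEP one ("deepening"), and exactness from a shallow certificate

The exactness theorem of the visible pair descent
(`KolyvaginDescent.VisiblePairHypothesesM.sel₁_eq_and_card_sel₂_eq_of_primitive`,
`HeegnerPointsKolyvaginVisibleDescentPairExactProofs`: McCallum Thm. 5.4 / Cor. 5.6 in the case
`M₁ = 0`) consumes a `p`-PRIMITIVE odd-depth class `c₂(ℓ₀)` at a Kolyvagin prime `ℓ₀` OF THE DATA,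
i.e. of level `p^M` with `M ≥ 3M₀` (DEEP: `Frob_{ℓ₀} = Frob_∞` on `K(E[p^M])`). Kolyvagin's
hypothesis as printed — McCallum §1, *"Suppose one of Kolyvagin's points `P_n` satisfies
`P_n ∉ pE(K(P_n))`"*, with `n ∈ S(1)` (p. 287: *"by adding the hypothesis that `p ∤ P_n` for some
`n ∈ S(1)`"*) — is a SHALLOW certificate: `ℓ₀ ∈ S₁(1)` (`p ∣ ℓ₀ + 1`, `p ∣ a_{ℓ₀}` only). The passage
shallow → deep is McCallum's Prop. 5.2 (*"Let `M > M_r`. There exists `n ∈ S_r(M)` such that `c_M(n)`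
had order `p^{M−M_r}`"*), whose proof (p. 286–287) replaces the shallow prime by a deep one using
Prop. 3.1 (Čebotarev), Lemma 5.3 (an auxiliary class `c` and local duality at `λ'`), Prop. 2.2 (the
reciprocity law `∑_v c_{M_r+1}(nl')_v ∪ c_v = 0`, display (13)), Lemma 4.3 and Prop. 4.4.

This file isolates that argument for `r = 1`, `M_1 = 0`, as PURE ALGEBRA on the level-`p` groups
(`U = H¹(ℚ, E[p])` carrying the even-depth class `c_1(ℓ₀ℓ')` and the auxiliary class, `Y =
H¹(ℚ, E^{(d_K)}[p])` carrying `c_1(ℓ₀)` and `c_1(ℓ')`; at `p = 2` the pair `(E, E^{(d_K)})` over `ℚ`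
of the BSD route `GenusKolyvaginAtTwo`, LINE 6), every arithmetic input displayed:

* `KolyvaginDescent.exists_deep_certificate_of_shallow` — from: Čebotarev for the pure pair
  `{(u, 0), (0, y₀)}` at deep primes (`hceb`; at `2` the tree's
  `GenusExact.SelmerDescent.cebotarev_visible_rat_field_of_not_isSquare` with `Nv = (1, 1)`, given the
  visibility of that pair), Lemma 4.3 for `c_1(ℓ₀ℓ')` (`h43`), Prop. 4.4 at the deep `λ'` in Selmer
  form (`h44sel`) and at the shallow `λ₀` in order form (`h44ord`) — both instances of the route's Q2
  `KolyvaginRelationAtTwo` at level `M = 1` —, the two-place reciprocity law for the local pairings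
  (`hrec`, Prop. 2.2 with isotropy of the Selmer conditions elsewhere), local duality at `λ'` at level
  `p` (`hndeg`, Lemma 5.3: `𝓛^⊥ = 𝓛 ≅ ℤ/p`), and `c_{λ₀} = 0 ⟹ (c ∪ ·)_{λ₀} = 0` (`hstrict`): **there
  is a deep `ℓ' > b`, `ℓ' ≠ ℓ₀`, with `c_1(ℓ')_{λ₀} ≠ 0`** — in particular `c_1(ℓ') ≠ 0`, i.e.
  `P_{ℓ'} ∉ pE(K_{ℓ'})`: a DEEP depth-one certificate.
* `KolyvaginDescent.exists_deep_certificate_of_shallow_of_transfer` — the same with the local pairings as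
  predicates and reciprocity in the `inv`-free TRANSFER form `a_{λ₀} ∪ c_{λ₀} = 0 ⟺ a_λ ∪ c_λ = 0`
  (the shape of the tree's two-place reciprocity over a number field);
* `KolyvaginDescent.VisiblePairHypothesesM.sel₁_eq_and_card_sel₂_eq_of_shallow` (and `…_of_transfer`) — exactness
  (`Sel₁ = ℤx`, `#Sel₂ = p^{2M₀}`) from a SHALLOW certificate: the deepening data with `Deep = S.Kol`
  plus the link `hlink` (`c_1(ℓ')_{λ₀} ≠ 0 ⟹ p^{M−1} c₂(ℓ') ≠ 0`: Lemma 4.6, `ι c_1(ℓ') = p^{M−1} c_M(ℓ')`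
  with `ι : H¹(ℚ, E^{(d_K)}[p]) ↪ H¹(ℚ, E^{(d_K)}[p^M])`), fed into `sel₁_eq_and_card_sel₂_eq_of_primitive`.

Pure algebra; no definition, no named fact; nothing here is a claim about BSD. The case of a shallow
certificate of depth `r ≥ 2` (McCallum's `M_r = 0 < M_1`) needs the full Prop. 5.2 and the lower bound
`⊕ (ℤ/p^{M_{i−1}−M_i})² ⊆ Ш` (p. 287) and is NOT covered.

## References

* W. G. McCallum, *Kolyvagin's work on Shafarevich–Tate groups*, LMS LNS 153 (1991): §1 Theorem;
  §2 Prop. 2.2; §4 Lemma 4.3, Prop. 4.4, Lemma 4.6; §5 Lemma 5.1, Prop. 5.2 (proof, (7)–(13)),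
  Lemma 5.3, Thm. 5.4, Cor. 5.6, p. 287. [McCallumLMS1991]
* V. A. Kolyvagin, Izv. 1989, §3 (the pair `(E, E^D)` over `ℚ`). [Kolyvagin1989Izv]
-/

open scoped Classical

namespace Literature.NumberTheory.EllipticCurves

namespace KolyvaginDescent

/-! ## The deepening step (McCallum Prop. 5.2, `r = 1`, `M_1 = 0`) -/

/-- **A shallow depth-one certificate yields a deep one** (McCallum's Prop. 5.2 for `r = 1`, the
replacement step of its proof, abstract). Data on the level-`p` groups `U` (classes of the member
carrying the even depths; the auxiliary class) and `Y` (odd depths): deep primes `Deep`, places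
`pl`, the shallow prime `ℓ₀`, Selmer conditions `LocU`, strict conditions `AU`, `AY` at (the places
of) natural numbers; `y₀ = c_1(ℓ₀)`; an auxiliary class `u` Selmer off `ℓ₀` (`hu`; McCallum (8));
`uu ℓ = c_1(ℓ₀ℓ)`, `w ℓ = c_1(ℓ)` for deep `ℓ`. Hypotheses: `hpl` (a deep `ℓ ≠ ℓ₀` has a place
`≠` that of `ℓ₀`); `hceb` (Čebotarev for the pure pair `{u, y₀}`: deep `ℓ > b` with `y₀,λ ≠ 0`,
`u_λ ≠ 0` — (11), (12) realised by Prop. 3.1); `h43` (Lemma 4.3: `c_1(ℓ₀ℓ)` Selmer off `ℓ₀ℓ`);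
`h44sel` (Prop. 4.4 at `λ`: `c_1(ℓ₀ℓ)` Selmer at `λ ⟺ c_1(ℓ₀)_λ = 0`); `h44ord` (Prop. 4.4 at `λ₀`:
`c_1(ℓ₀ℓ)_{λ₀} = 0 ⟺ c_1(ℓ)_{λ₀} = 0`); local pairings `π v` with the two-place reciprocity law
`hrec` (Prop. 2.2, display (13): the terms off `{λ₀, λ}` vanish by isotropy), local duality at a deep
`λ` (`hndeg`, Lemma 5.3 at level `p`: a class outside `𝓛_λ` pairs non-trivially with a non-zero
class of `𝓛_λ ≅ ℤ/p`), and `hstrict` (a class vanishing at `λ₀` pairs to `0` there). Conclusion: a deep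
`ℓ > b`, `ℓ ≠ ℓ₀`, with **`c_1(ℓ)_{λ₀} ≠ 0`** (so `c_1(ℓ) ≠ 0`: `P_ℓ ∉ pE(K_ℓ)`).
[cite: McCallumLMS1991, §5 Prop. 5.2 (proof, (7)–(13)), Lemma 5.3, §2 Prop. 2.2, §4 Prop. 4.4] -/
theorem exists_deep_certificate_of_shallow
    {U Y : Type*} [AddCommGroup U] [AddCommGroup Y] {Pl R : Type*} [AddCommGroup R]
    (Deep : ℕ → Prop) (pl : ℕ → Pl) (ℓ₀ : ℕ)
    (LocU : Pl → AddSubgroup U) (AU : ℕ → AddSubgroup U) (AY : ℕ → AddSubgroup Y)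
    (y₀ : Y) (u : U) (hu : ∀ v, v ≠ pl ℓ₀ → u ∈ LocU v) (uu : ℕ → U) (w : ℕ → Y)
    (hpl : ∀ ℓ, Deep ℓ → ℓ ≠ ℓ₀ → pl ℓ ≠ pl ℓ₀)
    (hceb : ∀ b : ℕ, ∃ ℓ, b < ℓ ∧ Deep ℓ ∧ y₀ ∉ AY ℓ ∧ u ∉ AU ℓ)
    (h43 : ∀ ℓ, Deep ℓ → ℓ ≠ ℓ₀ → ∀ v, v ≠ pl ℓ₀ → v ≠ pl ℓ → uu ℓ ∈ LocU v)
    (h44sel : ∀ ℓ, Deep ℓ → ℓ ≠ ℓ₀ → (uu ℓ ∈ LocU (pl ℓ) ↔ y₀ ∈ AY ℓ))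
    (h44ord : ∀ ℓ, Deep ℓ → ℓ ≠ ℓ₀ → (uu ℓ ∈ AU ℓ₀ ↔ w ℓ ∈ AY ℓ₀))
    (π : Pl → U →+ U →+ R)
    (hrec : ∀ ℓ, Deep ℓ → ℓ ≠ ℓ₀ → ∀ a c : U, (∀ v, v ≠ pl ℓ₀ → v ≠ pl ℓ → a ∈ LocU v) →
      (∀ v, v ≠ pl ℓ₀ → c ∈ LocU v) → π (pl ℓ₀) a c + π (pl ℓ) a c = 0)
    (hndeg : ∀ ℓ, Deep ℓ → ∀ a c : U, a ∉ LocU (pl ℓ) → c ∈ LocU (pl ℓ) → c ∉ AU ℓ →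
      π (pl ℓ) a c ≠ 0)
    (hstrict : ∀ a c : U, a ∈ AU ℓ₀ → π (pl ℓ₀) a c = 0)
    (b : ℕ) :
    ∃ ℓ, b < ℓ ∧ Deep ℓ ∧ ℓ ≠ ℓ₀ ∧ w ℓ ∉ AY ℓ₀ := by
  -- a deep prime `ℓ > max b ℓ₀` with `y₀,λ ≠ 0` and `u_λ ≠ 0` (Prop. 3.1 / Cor. 3.2)
  obtain ⟨ℓ, hbℓ, hℓ, hy₀, huℓ⟩ := hceb (max b ℓ₀)
  have hb : b < ℓ := lt_of_le_of_lt (le_max_left _ _) hbℓ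
  have hne : ℓ ≠ ℓ₀ := fun h ↦ (lt_irrefl ℓ₀) (lt_of_le_of_lt (le_max_right b ℓ₀) (h ▸ hbℓ))
  refine ⟨ℓ, hb, hℓ, hne, fun hw ↦ ?_⟩
  -- `c_1(ℓ₀ℓ)` is NOT Selmer at `λ` (Prop. 4.4 at `λ`, `c_1(ℓ₀)_λ ≠ 0`)
  have ha : uu ℓ ∉ LocU (pl ℓ) := fun h ↦ hy₀ ((h44sel ℓ hℓ hne).mp h)
  -- so the local term at `λ` does not vanish (Lemma 5.3) ...
  have hlam : π (pl ℓ) (uu ℓ) u ≠ 0 := hndeg ℓ hℓ (uu ℓ) u ha (hu _ (hpl ℓ hℓ hne)) huℓ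
  -- ... hence neither does the term at `λ₀` (reciprocity), so `c_1(ℓ₀ℓ)_{λ₀} ≠ 0`
  have hsum := hrec ℓ hℓ hne (uu ℓ) u (h43 ℓ hℓ hne) hu
  have hlam0 : π (pl ℓ₀) (uu ℓ) u ≠ 0 := fun h0 ↦ hlam (by rwa [h0, zero_add] at hsum)
  have ha₀ : uu ℓ ∉ AU ℓ₀ := fun h ↦ hlam0 (hstrict _ _ h)
  -- Prop. 4.4 at `λ₀`: then `c_1(ℓ)_{λ₀} ≠ 0`
  exact ha₀ ((h44ord ℓ hℓ hne).mpr hw)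

/-- **The deepening step, TRANSFER form** (McCallum Prop. 5.2, `r = 1`): as
`exists_deep_certificate_of_shallow`, with the local pairings replaced by predicates `NZ ℓ a c`
("`a_λ ∪ c_λ ≠ 0`") and the reciprocity law in the `inv`-free form **`a_{λ₀} ∪ c_{λ₀} = 0 ⟺ a_λ ∪ c_λ = 0`**
for `a` Selmer off `{λ₀, λ}`, `c` Selmer off `λ₀` — the shape of the tree's
`GenusExact.FrobeniusCriterion.cupProduct_localization_eq_zero_iff_of_selmer_off_pair` (any number field,
from Poitou–Tate). [cite: McCallumLMS1991, §5 Prop. 5.2 (proof, (7)–(13)), Lemma 5.3, §2 Prop. 2.2, §4 Prop. 4.4] -/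
theorem exists_deep_certificate_of_shallow_of_transfer
    {U Y : Type*} [AddCommGroup U] [AddCommGroup Y] {Pl : Type*}
    (Deep : ℕ → Prop) (pl : ℕ → Pl) (ℓ₀ : ℕ)
    (LocU : Pl → AddSubgroup U) (AU : ℕ → AddSubgroup U) (AY : ℕ → AddSubgroup Y)
    (y₀ : Y) (u : U) (hu : ∀ v, v ≠ pl ℓ₀ → u ∈ LocU v) (uu : ℕ → U) (w : ℕ → Y)
    (hpl : ∀ ℓ, Deep ℓ → ℓ ≠ ℓ₀ → pl ℓ ≠ pl ℓ₀)
    (hceb : ∀ b : ℕ, ∃ ℓ, b < ℓ ∧ Deep ℓ ∧ y₀ ∉ AY ℓ ∧ u ∉ AU ℓ)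
    (h43 : ∀ ℓ, Deep ℓ → ℓ ≠ ℓ₀ → ∀ v, v ≠ pl ℓ₀ → v ≠ pl ℓ → uu ℓ ∈ LocU v)
    (h44sel : ∀ ℓ, Deep ℓ → ℓ ≠ ℓ₀ → (uu ℓ ∈ LocU (pl ℓ) ↔ y₀ ∈ AY ℓ))
    (h44ord : ∀ ℓ, Deep ℓ → ℓ ≠ ℓ₀ → (uu ℓ ∈ AU ℓ₀ ↔ w ℓ ∈ AY ℓ₀))
    (NZ : ℕ → U → U → Prop)
    (hrec : ∀ ℓ, Deep ℓ → ℓ ≠ ℓ₀ → ∀ a c : U, (∀ v, v ≠ pl ℓ₀ → v ≠ pl ℓ → a ∈ LocU v) →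
      (∀ v, v ≠ pl ℓ₀ → c ∈ LocU v) → (NZ ℓ₀ a c ↔ NZ ℓ a c))
    (hndeg : ∀ ℓ, Deep ℓ → ∀ a c : U, a ∉ LocU (pl ℓ) → c ∈ LocU (pl ℓ) → c ∉ AU ℓ → NZ ℓ a c)
    (hstrict : ∀ a c : U, a ∈ AU ℓ₀ → ¬ NZ ℓ₀ a c)
    (b : ℕ) :
    ∃ ℓ, b < ℓ ∧ Deep ℓ ∧ ℓ ≠ ℓ₀ ∧ w ℓ ∉ AY ℓ₀ := by
  obtain ⟨ℓ, hbℓ, hℓ, hy₀, huℓ⟩ := hceb (max b ℓ₀)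
  have hb : b < ℓ := lt_of_le_of_lt (le_max_left _ _) hbℓ
  have hne : ℓ ≠ ℓ₀ := fun h ↦ (lt_irrefl ℓ₀) (lt_of_le_of_lt (le_max_right b ℓ₀) (h ▸ hbℓ))
  refine ⟨ℓ, hb, hℓ, hne, fun hw ↦ ?_⟩
  have ha : uu ℓ ∉ LocU (pl ℓ) := fun h ↦ hy₀ ((h44sel ℓ hℓ hne).mp h)
  have hlam : NZ ℓ (uu ℓ) u := hndeg ℓ hℓ (uu ℓ) u ha (hu _ (hpl ℓ hℓ hne)) huℓ
  have hlam0 : NZ ℓ₀ (uu ℓ) u := (hrec ℓ hℓ hne (uu ℓ) u (h43 ℓ hℓ hne) hu).mpr hlam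
  have ha₀ : uu ℓ ∉ AU ℓ₀ := fun h ↦ hstrict _ _ h hlam0
  exact ha₀ ((h44ord ℓ hℓ hne).mpr hw)

/-! ## Exactness from a shallow certificate -/

namespace VisiblePairHypothesesM

variable {V₁ V₂ : Type*} [AddCommGroup V₁] [AddCommGroup V₂] {Pl : Type*}
variable {H : Type*} [AddCommGroup H] (S : VisiblePairHypothesesM V₁ V₂ Pl H)

/-- **Exactness for a VISIBLE pair from a SHALLOW depth-one certificate** (McCallum §1 Theorem with
p. 287: `p ∤ P_{ℓ₀}` for a shallow `ℓ₀ ∈ S₁(1)`; Thm. 5.4 / Cor. 5.6 via Prop. 5.2 for `r = 1`). Inputs: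
those of `sel₁_eq_and_card_sel₂_eq_of_primitive` except the deep certificate, the deepening data of
`exists_deep_certificate_of_shallow` with `Deep = S.Kol` (the structure's Kolyvagin primes, of level
`p^M`), and the link `hlink`: `c_1(ℓ)_{λ₀} ≠ 0 ⟹ p^{M−1} c₂(ℓ) ≠ 0` (`c_1(ℓ) ≠ 0` read at level `p^M`
through Lemma 4.6, `ι c_1(ℓ) = p^{M−1} c_M(ℓ)`, `ι : H¹(E^D[p]) ↪ H¹(E^D[p^M])`). Conclusion:
**`Sel₁ = ℤx` and `#Sel₂ = p^{2M₀}`.** [cite: McCallumLMS1991, §1 Theorem, p. 287, Prop. 5.2, Thm. 5.4, Cor. 5.6]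
[cite: Kolyvagin1989Izv, §3] -/
theorem sel₁_eq_and_card_sel₂_eq_of_shallow [Finite S.Sel₁] [Finite S.Sel₂]
    (P₁ : S.Sel₁ →+ S.Sel₁ →+ AddCircle (1 : ℚ)) (halt₁ : ∀ z, P₁ z z = 0)
    (hPx : ∀ t, P₁ ⟨S.x, S.x_mem⟩ t = 0)
    (hnd₁ : ∀ z : S.Sel₁, (∀ t, P₁ z t = 0) → (z : V₁) ∈ AddSubgroup.zmultiples S.x)
    (P₂ : S.Sel₂ →+ S.Sel₂ →+ AddCircle (1 : ℚ)) (halt₂ : ∀ z, P₂ z z = 0)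
    (hnd₂ : ∀ z : S.Sel₂, (∀ t, P₂ z t = 0) → z = 0)
    (hCTV : ∀ ℓ m : ℕ, S.Kol ℓ → KolSupp S.Kol (ℓ * m) → ¬ ℓ ∣ m →
      ∀ (j N a b : ℕ) (t : V₁ × V₂) (ht : t ∈ S.toVisibleSplit.Sel)
        (hz : ((S.p : ℤ) ^ j) • S.toVisibleSplit.c (ℓ * m) ∈ S.toVisibleSplit.Sel),
      ((S.p : ℤ) ^ N) • t = 0 → t ∈ S.toVisibleSplit.part (1 * (-1) ^ (ℓ * m).primeFactors.card) →
      (∀ q ∈ m.primeFactors, t ∈ S.toVisibleSplit.A q) → S.M - S.M₀ ≤ j → N + S.M₀ ≤ S.M → N ≤ j →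
      a + b + 1 = N → ((S.p : ℤ) ^ (a + (j - N))) • S.toVisibleSplit.c m ∉ S.toVisibleSplit.A ℓ →
      ((S.p : ℤ) ^ b) • t ∉ S.toVisibleSplit.A ℓ →
      S.prodPairing P₁ P₂ ⟨_, hz⟩ ⟨t, ht⟩ ≠ 0)
    (hCeb : ∀ (T : Finset (V₁ × V₂)) (g₁ g₂ : V₁ × V₂) (ν : ℤ), (ν = 1 ∨ ν = -1) →
      g₁ ∈ S.toVisibleSplit.part ν → g₂ ∈ S.toVisibleSplit.part (-ν) →
      (∀ t ∈ T, ∃ e : ℤ, (e = 1 ∨ e = -1) ∧ t ∈ S.toVisibleSplit.part e) →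
      (∀ g ∈ AddSubgroup.closure (insert g₁ (insert g₂ (T : Set (V₁ × V₂)))),
        S.rK₁ g.1 + S.rK₂ g.2 = 0 → g = 0) →
      ∀ b : ℕ, ∃ ℓ, b < ℓ ∧ S.Kol ℓ ∧ (∀ t ∈ T, t ∈ (S.A₁ ℓ).prod (S.A₂ ℓ)) ∧
        (∀ j : ℕ, ((S.p : ℤ) ^ j) • g₁ ∈ (S.A₁ ℓ).prod (S.A₂ ℓ) ↔
          ((S.p : ℤ) ^ j) • g₁ ∈ AddSubgroup.closure (T : Set (V₁ × V₂))) ∧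
        (∀ j : ℕ, ((S.p : ℤ) ^ j) • g₂ ∈ (S.A₁ ℓ).prod (S.A₂ ℓ) ↔
          ((S.p : ℤ) ^ j) • g₂ ∈ AddSubgroup.closure (T : Set (V₁ × V₂))))
    (hcsupp₁ : ∀ n, KolSupp S.Kol n → Even n.primeFactors.card →
      ∀ v, (∀ q, S.Kol q → v ≠ S.pl q) → S.c₁ n ∈ S.Loc₁ v)
    (hcsupp₂ : ∀ n, KolSupp S.Kol n → Odd n.primeFactors.card →
      ∀ v, (∀ q, S.Kol q → v ≠ S.pl q) → S.c₂ n ∈ S.Loc₂ v)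
    (h3 : 3 * S.M₀ ≤ S.M)
    -- the deepening data (level `p`), `Deep = S.Kol`
    {U Y : Type*} [AddCommGroup U] [AddCommGroup Y] {Pl' R : Type*} [AddCommGroup R]
    (pl : ℕ → Pl') (ℓ₀ : ℕ)
    (LocU : Pl' → AddSubgroup U) (AU : ℕ → AddSubgroup U) (AY : ℕ → AddSubgroup Y)
    (y₀ : Y) (u : U) (hu : ∀ v, v ≠ pl ℓ₀ → u ∈ LocU v) (uu : ℕ → U) (w : ℕ → Y)
    (hpl : ∀ ℓ, S.Kol ℓ → ℓ ≠ ℓ₀ → pl ℓ ≠ pl ℓ₀)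
    (hceb : ∀ b : ℕ, ∃ ℓ, b < ℓ ∧ S.Kol ℓ ∧ y₀ ∉ AY ℓ ∧ u ∉ AU ℓ)
    (h43 : ∀ ℓ, S.Kol ℓ → ℓ ≠ ℓ₀ → ∀ v, v ≠ pl ℓ₀ → v ≠ pl ℓ → uu ℓ ∈ LocU v)
    (h44sel : ∀ ℓ, S.Kol ℓ → ℓ ≠ ℓ₀ → (uu ℓ ∈ LocU (pl ℓ) ↔ y₀ ∈ AY ℓ))
    (h44ord : ∀ ℓ, S.Kol ℓ → ℓ ≠ ℓ₀ → (uu ℓ ∈ AU ℓ₀ ↔ w ℓ ∈ AY ℓ₀))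
    (π : Pl' → U →+ U →+ R)
    (hrec : ∀ ℓ, S.Kol ℓ → ℓ ≠ ℓ₀ → ∀ a c : U, (∀ v, v ≠ pl ℓ₀ → v ≠ pl ℓ → a ∈ LocU v) →
      (∀ v, v ≠ pl ℓ₀ → c ∈ LocU v) → π (pl ℓ₀) a c + π (pl ℓ) a c = 0)
    (hndeg : ∀ ℓ, S.Kol ℓ → ∀ a c : U, a ∉ LocU (pl ℓ) → c ∈ LocU (pl ℓ) → c ∉ AU ℓ →
      π (pl ℓ) a c ≠ 0)
    (hstrict : ∀ a c : U, a ∈ AU ℓ₀ → π (pl ℓ₀) a c = 0)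
    (hlink : ∀ ℓ, S.Kol ℓ → ℓ ≠ ℓ₀ → w ℓ ∉ AY ℓ₀ → ((S.p : ℤ) ^ (S.M - 1)) • S.c₂ ℓ ≠ 0) :
    S.Sel₁ = AddSubgroup.zmultiples S.x ∧ Nat.card S.Sel₂ = S.p ^ (2 * S.M₀) := by
  obtain ⟨ℓ, -, hℓ, hne, hw⟩ := exists_deep_certificate_of_shallow S.Kol pl ℓ₀ LocU AU AY y₀ u hu uu
    w hpl hceb h43 h44sel h44ord π hrec hndeg hstrict 0
  exact S.sel₁_eq_and_card_sel₂_eq_of_primitive P₁ halt₁ hPx hnd₁ P₂ halt₂ hnd₂ hCTV hCeb hcsupp₁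
    hcsupp₂ h3 hℓ (hlink ℓ hℓ hne hw)

/-- **Exactness from a SHALLOW certificate, transfer form** (reciprocity as
`a_{λ₀} ∪ c_{λ₀} = 0 ⟺ a_λ ∪ c_λ = 0`; otherwise as `sel₁_eq_and_card_sel₂_eq_of_shallow`).
[cite: McCallumLMS1991, §1 Theorem, p. 287, Prop. 5.2, Thm. 5.4, Cor. 5.6] [cite: Kolyvagin1989Izv, §3] -/
theorem sel₁_eq_and_card_sel₂_eq_of_shallow_of_transfer [Finite S.Sel₁] [Finite S.Sel₂]
    (P₁ : S.Sel₁ →+ S.Sel₁ →+ AddCircle (1 : ℚ)) (halt₁ : ∀ z, P₁ z z = 0)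
    (hPx : ∀ t, P₁ ⟨S.x, S.x_mem⟩ t = 0)
    (hnd₁ : ∀ z : S.Sel₁, (∀ t, P₁ z t = 0) → (z : V₁) ∈ AddSubgroup.zmultiples S.x)
    (P₂ : S.Sel₂ →+ S.Sel₂ →+ AddCircle (1 : ℚ)) (halt₂ : ∀ z, P₂ z z = 0)
    (hnd₂ : ∀ z : S.Sel₂, (∀ t, P₂ z t = 0) → z = 0)
    (hCTV : ∀ ℓ m : ℕ, S.Kol ℓ → KolSupp S.Kol (ℓ * m) → ¬ ℓ ∣ m →
      ∀ (j N a b : ℕ) (t : V₁ × V₂) (ht : t ∈ S.toVisibleSplit.Sel)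
        (hz : ((S.p : ℤ) ^ j) • S.toVisibleSplit.c (ℓ * m) ∈ S.toVisibleSplit.Sel),
      ((S.p : ℤ) ^ N) • t = 0 → t ∈ S.toVisibleSplit.part (1 * (-1) ^ (ℓ * m).primeFactors.card) →
      (∀ q ∈ m.primeFactors, t ∈ S.toVisibleSplit.A q) → S.M - S.M₀ ≤ j → N + S.M₀ ≤ S.M → N ≤ j →
      a + b + 1 = N → ((S.p : ℤ) ^ (a + (j - N))) • S.toVisibleSplit.c m ∉ S.toVisibleSplit.A ℓ →
      ((S.p : ℤ) ^ b) • t ∉ S.toVisibleSplit.A ℓ →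
      S.prodPairing P₁ P₂ ⟨_, hz⟩ ⟨t, ht⟩ ≠ 0)
    (hCeb : ∀ (T : Finset (V₁ × V₂)) (g₁ g₂ : V₁ × V₂) (ν : ℤ), (ν = 1 ∨ ν = -1) →
      g₁ ∈ S.toVisibleSplit.part ν → g₂ ∈ S.toVisibleSplit.part (-ν) →
      (∀ t ∈ T, ∃ e : ℤ, (e = 1 ∨ e = -1) ∧ t ∈ S.toVisibleSplit.part e) →
      (∀ g ∈ AddSubgroup.closure (insert g₁ (insert g₂ (T : Set (V₁ × V₂)))),
        S.rK₁ g.1 + S.rK₂ g.2 = 0 → g = 0) →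
      ∀ b : ℕ, ∃ ℓ, b < ℓ ∧ S.Kol ℓ ∧ (∀ t ∈ T, t ∈ (S.A₁ ℓ).prod (S.A₂ ℓ)) ∧
        (∀ j : ℕ, ((S.p : ℤ) ^ j) • g₁ ∈ (S.A₁ ℓ).prod (S.A₂ ℓ) ↔
          ((S.p : ℤ) ^ j) • g₁ ∈ AddSubgroup.closure (T : Set (V₁ × V₂))) ∧
        (∀ j : ℕ, ((S.p : ℤ) ^ j) • g₂ ∈ (S.A₁ ℓ).prod (S.A₂ ℓ) ↔
          ((S.p : ℤ) ^ j) • g₂ ∈ AddSubgroup.closure (T : Set (V₁ × V₂))))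
    (hcsupp₁ : ∀ n, KolSupp S.Kol n → Even n.primeFactors.card →
      ∀ v, (∀ q, S.Kol q → v ≠ S.pl q) → S.c₁ n ∈ S.Loc₁ v)
    (hcsupp₂ : ∀ n, KolSupp S.Kol n → Odd n.primeFactors.card →
      ∀ v, (∀ q, S.Kol q → v ≠ S.pl q) → S.c₂ n ∈ S.Loc₂ v)
    (h3 : 3 * S.M₀ ≤ S.M)
    -- the deepening data (level `p`), `Deep = S.Kol`, transfer form
    {U Y : Type*} [AddCommGroup U] [AddCommGroup Y] {Pl' : Type*}
    (pl : ℕ → Pl') (ℓ₀ : ℕ)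
    (LocU : Pl' → AddSubgroup U) (AU : ℕ → AddSubgroup U) (AY : ℕ → AddSubgroup Y)
    (y₀ : Y) (u : U) (hu : ∀ v, v ≠ pl ℓ₀ → u ∈ LocU v) (uu : ℕ → U) (w : ℕ → Y)
    (hpl : ∀ ℓ, S.Kol ℓ → ℓ ≠ ℓ₀ → pl ℓ ≠ pl ℓ₀)
    (hceb : ∀ b : ℕ, ∃ ℓ, b < ℓ ∧ S.Kol ℓ ∧ y₀ ∉ AY ℓ ∧ u ∉ AU ℓ)
    (h43 : ∀ ℓ, S.Kol ℓ → ℓ ≠ ℓ₀ → ∀ v, v ≠ pl ℓ₀ → v ≠ pl ℓ → uu ℓ ∈ LocU v)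
    (h44sel : ∀ ℓ, S.Kol ℓ → ℓ ≠ ℓ₀ → (uu ℓ ∈ LocU (pl ℓ) ↔ y₀ ∈ AY ℓ))
    (h44ord : ∀ ℓ, S.Kol ℓ → ℓ ≠ ℓ₀ → (uu ℓ ∈ AU ℓ₀ ↔ w ℓ ∈ AY ℓ₀))
    (NZ : ℕ → U → U → Prop)
    (hrec : ∀ ℓ, S.Kol ℓ → ℓ ≠ ℓ₀ → ∀ a c : U, (∀ v, v ≠ pl ℓ₀ → v ≠ pl ℓ → a ∈ LocU v) →
      (∀ v, v ≠ pl ℓ₀ → c ∈ LocU v) → (NZ ℓ₀ a c ↔ NZ ℓ a c))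
    (hndeg : ∀ ℓ, S.Kol ℓ → ∀ a c : U, a ∉ LocU (pl ℓ) → c ∈ LocU (pl ℓ) → c ∉ AU ℓ → NZ ℓ a c)
    (hstrict : ∀ a c : U, a ∈ AU ℓ₀ → ¬ NZ ℓ₀ a c)
    (hlink : ∀ ℓ, S.Kol ℓ → ℓ ≠ ℓ₀ → w ℓ ∉ AY ℓ₀ → ((S.p : ℤ) ^ (S.M - 1)) • S.c₂ ℓ ≠ 0) :
    S.Sel₁ = AddSubgroup.zmultiples S.x ∧ Nat.card S.Sel₂ = S.p ^ (2 * S.M₀) := by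
  obtain ⟨ℓ, -, hℓ, hne, hw⟩ := exists_deep_certificate_of_shallow_of_transfer S.Kol pl ℓ₀ LocU AU AY y₀
    u hu uu w hpl hceb h43 h44sel h44ord NZ hrec hndeg hstrict 0
  exact S.sel₁_eq_and_card_sel₂_eq_of_primitive P₁ halt₁ hPx hnd₁ P₂ halt₂ hnd₂ hCTV hCeb hcsupp₁
    hcsupp₂ h3 hℓ (hlink ℓ hℓ hne hw)

end VisiblePairHypothesesM

end KolyvaginDescent

end Literature.NumberTheory.EllipticCurves
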